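import Mathlib
import Summits.CriticalPhenomena.CardyFormulaZ2.Theses.CardyBoundaryCoulombGas
import Summits.CriticalPhenomena.CardyFormulaZ2.Theorems.CardyMagicRigidityLoopsToCrossingsStubDiscreteCrossingOfPathIn
import Summits.CriticalPhenomena.CardyFormulaZ2.Theorems.CardyMagicRigidityLoopsToCrossingsStubNotDiscreteCrossingOfDualPathIn
import Summits.CriticalPhenomena.CardyFormulaZ2.Theorems.CardyMagicRigidityLoopsToCrossingsStubCardyContinuity
import Summits.CriticalPhenomena.CardyFormulaZ2.Theorems.CardyMagicRigidityLoopsToCrossingsStubComparisonGeometry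
import Summits.CriticalPhenomena.CardyFormulaZ2.Theorems.CardyMagicRigidityLoopsToCrossingsStubCyclicFlip
import Literature.Probability.Percolation.BoxCrossingUpperBound
import Literature.Probability.Percolation.PlanarDuality
import Literature.Probability.Percolation.LatticePathArcs
import Literature.Probability.Percolation.HalfSpacePinnedPairs
import Literature.Probability.Percolation.SharpnessDCTProofs
import Literature.Probability.Percolation.ZdNearCriticalWindow
import Literature.Probability.RandomPlanarGeometry.JordanIndex
import Literature.Probability.RandomPlanarGeometry.ConformalRectangleProofs

/-!
# The deterministic sandwich for rectilinear approximants (bond-`ℤ²`)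

Support file for `RectilinearSuffices` / `Assembly` (route CardyBoundaryCoulombGas of
`CardyFormulaZ2`, items stmt-CriticalPhenomena-5663 / 13894). Given the rectilinear
approximants `P` of the comparison quads `Q` (lower) / `N` (upper) of a conformal rectangle `R`
(same marks, boundary loops pointwise `ρ`-close; e.g. `exists_rectilinear_close` of
`CardyBoundaryCoulombGasRectilinearSufficesApprox.lean`), this file
proves the two DETERMINISTIC inclusions of crossing events at every small mesh and the
per-mesh probability inequality of the upper side:

* `carrier_subset_cthickening_of_dist_boundary_le` — a pointwise `ρ`-close loop bounds a domain
  inside the closed `ρ`-fattening (dog-on-leash for the index, exterior points);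
* `discreteCrossing_subset_of_lower` — a G02 crossing of `P_δ` (arc `0` to arc `2`) IS a G02
  crossing of `R_δ` (bond port of Bollobás–Riordan Ch. 7 Claim 19, tree stub A
  `stub_discreteCrossing_of_pathIn`), the arc vertices of `P_δ` being within `δ` of its arcs
  (`infDist_le_of_mem_discreteArc`);
* `discreteCrossing_subset_plate` — a G02 crossing of `P_δ` for an approximant of the upper quad
  is an open plate path of `N` with room `r/2`;
* `bond_le_one_sub_real_openCrossing` — `bond R δ ≤ 1 - P[open plate path of N]` (tree stub B
  `stub_not_discreteCrossing_of_dualPathIn` + bond self-duality at `1/2`; port of the glue of line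
  `oracle-sandwich` of crux `LoopsToCrossings`).

References: B. Bollobás, O. Riordan, *Percolation* (2006), Ch. 7 Lemma 14 p. 184, Claims 19–20
p. 192, remark p. 195; S. Smirnov, C. R. Acad. Sci. Paris 333 (2001), §2.
-/

noncomputable section

namespace Summit.CriticalPhenomena.CardyFormulaZ2.Theorems

namespace RectilinearApproximation

open Set Metric List Filter Topology MeasureTheory
open Literature.Probability.LatticeModels Literature.Probability.Percolation
open Literature.Probability.RandomPlanarGeometry
open Summit.CriticalPhenomena.CardyFormulaZ2.Cruxes.LoopsToCrossings.OracleSandwich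
  (stub_discreteCrossing_of_pathIn stub_not_discreteCrossing_of_dualPathIn stub_cardyContinuity
    stub_comparisonGeometry stub_cyclicFlip segment_meshPoint_subset_closedBall_z2)
open Summit.CriticalPhenomena.CardyFormulaZ2.Theses.CardyBoundaryCoulombGas
  (RectilinearCardy RectilinearSuffices Assembly)

/-! ### Dog-on-leash on the exterior: a close loop bounds a close domain -/

/-- **Dog-on-leash for Jordan domains, exterior points.** If the boundary loop of `D'` is
pointwise closer to that of `D` than the point `z₀ ∉ ∂D` is to the corresponding boundary point,
the two loops have the same index about `z₀` (Rouché for loops, `wind_eq_of_norm_sub_lt`).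
[folklore] -/
theorem index_eq_index_of_dist_lt (D D' : JordanDomain) {z₀ : ℂ} (hz₀ : z₀ ∉ frontier D.carrier)
    (hclose : ∀ t, dist (D'.boundary t) (D.boundary t) < dist z₀ (D.boundary t)) :
    D'.index z₀ = D.index z₀ := by
  have hD'1 : D'.boundary 0 = D'.boundary 1 := by
    have := D'.periodic_boundary 0; rw [zero_add] at this; exact this.symm
  have hD1 : D.boundary 0 = D.boundary 1 := by
    have := D.periodic_boundary 0; rw [zero_add] at this; exact this.symm
  refine Literature.Topology.PlaneTopology.wind_eq_of_norm_sub_lt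
    ((D'.continuous_boundary.sub continuous_const).continuousOn) (by rw [hD'1])
    ⟨(D.continuous_boundary.sub continuous_const).continuousOn, fun t _ ↦ ?_, by rw [hD1]⟩
    fun t _ ↦ ?_
  · exact sub_ne_zero.2 fun h0 ↦ hz₀ (by rw [← h0]; exact D.boundary_mem_frontier t)
  · rw [sub_sub_sub_cancel_right, ← dist_eq_norm, ← dist_eq_norm, dist_comm (D.boundary t) z₀]
    exact hclose t

/-- **A pointwise `ρ`-close loop bounds a domain inside the closed `ρ`-fattening**: if
`dist (P.boundary u) (D.boundary u) ≤ ρ` for all `u` then `P ⊆ cthickening ρ D`. (A point of `P`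
farther than `ρ` from `closure D` would have index `0` for `∂D`, hence for `∂P` by the leash,
contradicting `index ≠ 0` inside `P`.) [folklore] -/
theorem carrier_subset_cthickening_of_dist_boundary_le (D P : JordanDomain) {ρ : ℝ}
    (h : ∀ u, dist (P.boundary u) (D.boundary u) ≤ ρ) : P.carrier ⊆ cthickening ρ D.carrier := by
  intro z hz
  by_contra hzt
  have hfar : ∀ y ∈ closure D.carrier, ρ < dist z y := by
    intro y hy
    by_contra hle
    push Not at hle
    exact hzt (by rw [← cthickening_closure]; exact mem_cthickening_of_dist_le z y ρ _ hy hle)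
  have hρ : 0 ≤ ρ := (dist_nonneg).trans (h 0)
  have hzcl : z ∉ closure D.carrier := fun hzc => by
    have := hfar z hzc; rw [dist_self] at this; linarith
  have hzf : z ∉ frontier D.carrier := fun hzf' => hzcl (frontier_subset_closure hzf')
  have hidx : P.index z = D.index z :=
    index_eq_index_of_dist_lt D P hzf fun t =>
      (h t).trans_lt (hfar _ (frontier_subset_closure (D.boundary_mem_frontier t)))
  have h0 : D.index z = 0 := D.index_eq_zero_of_mem_exterior hzcl
  exact P.index_ne_zero_of_mem_carrier hz (hidx.trans h0)

/-- With the same mark parameters and a pointwise `ρ`-close boundary loop, each arc of `P` lies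
in the closed `ρ`-fattening of the corresponding arc of `Q`. [folklore] -/
theorem arc_subset_cthickening_of_dist_boundary_le {k : ℕ} (Q P : MarkedDomain k) {ρ : ℝ}
    (h : ∀ u, dist (P.boundary u) (Q.boundary u) ≤ ρ) (hmark : ∀ i, P.mark i = Q.mark i) (i : Fin k) :
    P.arc i ⊆ cthickening ρ (Q.arc i) := by
  have hnext : P.nextMark i = Q.nextMark i := by
    simp only [MarkedDomain.nextMark, hmark]
  rintro _ ⟨t, ht, rfl⟩
  refine mem_cthickening_of_dist_le _ (Q.boundary t) ρ _ ⟨t, ?_, rfl⟩ (h t)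
  rwa [hmark, hnext] at ht

/-! ### Mesh bookkeeping: boundary vertices are one mesh off the frontier -/

/-- A boundary vertex of the discrete domain `Ω_δ` of an open set is within `δ` of `∂Ω`: either
the closed mesh edge to the offending neighbour leaves `closure Ω` (then it crosses `∂Ω`), or
the neighbour is a frontier point (a mesh neighbour in `Ω` joined inside `closure Ω` would lie in
the same component). [folklore] -/
theorem infDist_frontier_le_of_mem_meshBoundary {Ω : Set ℂ} (hΩ : IsOpen Ω) {δ : ℝ} (hδ : 0 < δ)
    {x : Site 2} (hx : x ∈ meshBoundary Ω δ) : infDist (meshPoint δ x) (frontier Ω) ≤ δ := by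
  rw [mem_meshBoundary_iff'] at hx
  obtain ⟨hxD, y, hxy, hy⟩ := hx
  have hxΩ : meshPoint δ x ∈ Ω := meshDomain_subset_meshVertices Ω δ hxD
  have hseg_ball := segment_meshPoint_subset_closedBall_z2 hδ hxy
  by_cases hmesh : (meshGraph Ω δ).Adj x y
  · -- the neighbour is not in `Ω_δ`: it is a frontier point
    have hyD : y ∉ meshDomain Ω δ := by
      rcases hy with hy | hy
      · exact hy
      · exact absurd hmesh hy
    have hyΩ : meshPoint δ y ∉ Ω := fun hyΩ =>
      hyD (Literature.Probability.Percolation.mem_meshDomain_of_meshGraph_adj hxD hyΩ hmesh)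
    have hycl : meshPoint δ y ∈ closure Ω := (meshGraph_adj_iff.1 hmesh).2 (right_mem_segment _ _ _)
    have hyf : meshPoint δ y ∈ frontier Ω := ⟨hycl, by rw [hΩ.interior_eq]; exact hyΩ⟩
    refine (infDist_le_dist_of_mem hyf).trans ?_
    have := hseg_ball (right_mem_segment _ _ _)
    rwa [mem_closedBall, dist_comm] at this
  · -- the closed mesh edge leaves `closure Ω`, hence `Ω`: it crosses the frontier
    have hns : ¬ segment ℝ (meshPoint δ x) (meshPoint δ y) ⊆ Ω := fun hs =>
      hmesh (meshGraph_adj_iff.2 ⟨hxy, hs.trans subset_closure⟩)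
    obtain ⟨f, hf, hff⟩ := exists_mem_segment_frontier hΩ hxΩ hns
    refine (infDist_le_dist_of_mem hff).trans ?_
    have := hseg_ball hf
    rwa [mem_closedBall, dist_comm] at this

/-- A vertex of the discrete arc of `A ⊆ ∂Ω` is within `δ` of `A` (it is within `δ` of
`∂Ω = A ∪ (∂Ω ∖ A)` and at least as close to `A` as to `∂Ω ∖ A`). [folklore] -/
theorem infDist_le_of_mem_discreteArc {Ω : Set ℂ} (hΩ : IsOpen Ω) {δ : ℝ} (hδ : 0 < δ) {A : Set ℂ}
    {x : Site 2} (hx : x ∈ discreteArc Ω δ A) (hne : (frontier Ω).Nonempty) :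
    infDist (meshPoint δ x) A ≤ δ := by
  obtain ⟨hxb, hxA⟩ := hx
  have hfr := infDist_frontier_le_of_mem_meshBoundary hΩ hδ hxb
  refine le_of_forall_pos_lt_add fun ε hε => ?_
  obtain ⟨f, hf, hfd⟩ := (infDist_lt_iff hne).1 (show infDist (meshPoint δ x) (frontier Ω) < δ + ε by linarith)
  by_cases hfA : f ∈ A
  · exact (infDist_le_dist_of_mem hfA).trans_lt hfd
  · exact hxA.trans_lt ((infDist_le_dist_of_mem (show f ∈ frontier Ω \ A from ⟨hf, hfA⟩)).trans_lt hfd)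

/-- An open crossing of `Ω_δ` (the graph `openGraph ω ⊓ discreteDomainGraph Ω δ`) from a vertex
of `Ω_δ` is an open `ℤ²`-path inside the vertex set `meshDomain Ω δ`. [folklore] -/
theorem pathIn_meshDomain_of_reachable {Ω : Set ℂ} {δ : ℝ} {ω : BondConfig (Site 2)} {a b : Site 2}
    (ha : a ∈ meshDomain Ω δ) (h : (openGraph ω ⊓ discreteDomainGraph Ω δ).Reachable a b) :
    PathIn (openGraph ω ⊓ zdGraph 2) (meshDomain Ω δ) a b := by
  rw [SimpleGraph.reachable_iff_reflTransGen] at h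
  refine ⟨ha, ?_⟩
  induction h with
  | refl => exact Relation.ReflTransGen.refl
  | @tail p q _ hpq ih =>
    have h1 : (openGraph ω).Adj p q := ((SimpleGraph.inf_adj _ _ _ _).1 hpq).1
    have h2 := discreteDomainGraph_adj_iff.1 ((SimpleGraph.inf_adj _ _ _ _).1 hpq).2
    exact ih.tail ⟨(SimpleGraph.inf_adj _ _ _ _).2 ⟨h1, meshGraph_le_zdGraph _ _ h2.1⟩, h2.2.2⟩

/-- Monotonicity of `PathIn` in the graph and the ambient set. [folklore] -/
theorem pathIn_mono {V : Type*} {G G' : SimpleGraph V} {S S' : Set V} {u v : V} (hG : G ≤ G')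
    (hS : S ⊆ S') (h : PathIn G S u v) : PathIn G' S' u v := by
  obtain ⟨hu, hr⟩ := h
  refine ⟨hS hu, ?_⟩
  induction hr with
  | refl => exact Relation.ReflTransGen.refl
  | tail _ hbc ih => exact ih.tail ⟨hG hbc.1, hS hbc.2⟩

/-! ### The two deterministic inclusions of crossing events -/

/-- **Lower inclusion.** Let `R` be a conformal rectangle with stub-A constants `δ₀, t₀`, let `Q`
be a lower comparison quad with room `r` and lateral margin `m` (clauses of `exists_lowerQuad`
at plate margin `t₀`), and let `P` be a conformal rectangle with the marks of `Q` whose boundary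
loop is pointwise `ρ`-close to that of `Q`, `ρ ≤ r/2`. Then for `0 < δ < min δ₀ m`, `δ ≤ r/2`,
every open crossing of `P_δ` from its arc `0` to its arc `2` is an open crossing of `R_δ`.
[folklore] -/
theorem discreteCrossing_subset_of_lower (R Q P : ConformalRectangle) {δ₀ t₀ r m ρ δ : ℝ}
    (hAfor : ∀ δ t : ℝ, 0 < δ → δ < δ₀ → 0 ≤ t → t ≤ t₀ →
        ∀ (ω : BondConfig (Site 2)) (S : Set (Site 2)) (u v : Site 2),
          (∀ x ∈ S, meshPoint δ x ∉ R.carrier →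
            infDist (meshPoint δ x) (R.arc 0) ≤ t ∨ infDist (meshPoint δ x) (R.arc 2) ≤ t) →
          (∀ x ∈ S, meshPoint δ x ∈ R.carrier →
            δ < infDist (meshPoint δ x) (R.arc 1) ∧ δ < infDist (meshPoint δ x) (R.arc 3)) →
          meshPoint δ u ∉ R.carrier → infDist (meshPoint δ u) (R.arc 0) ≤ t →
          meshPoint δ v ∉ R.carrier → infDist (meshPoint δ v) (R.arc 2) ≤ t →
          PathIn (openGraph ω ⊓ zdGraph 2) S u v →
          ω ∈ discreteCrossing R.carrier δ (R.arc 0) (R.arc 2))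
    (hL1 : ∀ z ∈ cthickening r Q.carrier, z ∉ R.carrier →
      infDist z (R.arc 0) ≤ t₀ ∨ infDist z (R.arc 2) ≤ t₀)
    (hL2 : ∀ z ∈ cthickening r Q.carrier, z ∈ R.carrier →
      m ≤ infDist z (R.arc 1) ∧ m ≤ infDist z (R.arc 3))
    (hL3 : ∀ z ∈ cthickening r (Q.arc 0), z ∉ R.carrier ∧ infDist z (R.arc 0) ≤ t₀)
    (hL4 : ∀ z ∈ cthickening r (Q.arc 2), z ∉ R.carrier ∧ infDist z (R.arc 2) ≤ t₀)
    (hclose : ∀ u, dist (P.boundary u) (Q.boundary u) ≤ ρ) (hmark : ∀ i, P.mark i = Q.mark i)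
    (hρ : 0 ≤ ρ) (hρr : ρ ≤ r / 2) (hδ : 0 < δ) (hδ₀ : δ < δ₀) (hδm : δ < m) (hδr : δ ≤ r / 2)
    (ht₀ : 0 ≤ t₀) :
    discreteCrossing P.carrier δ (P.arc 0) (P.arc 2) ⊆ discreteCrossing R.carrier δ (R.arc 0) (R.arc 2) := by
  intro ω hω
  obtain ⟨a, ha, b, hb, hreach⟩ := hω
  have hPQ : P.carrier ⊆ cthickening r Q.carrier :=
    (carrier_subset_cthickening_of_dist_boundary_le Q.toJordanDomain P.toJordanDomain hclose).trans
      (cthickening_mono (by linarith) _)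
  have hfrne : (frontier P.carrier).Nonempty := ⟨_, P.boundary_mem_frontier 0⟩
  -- arc vertices of `P_δ` are in the `r`-fattening of the arcs of `Q`
  have harc : ∀ (i : Fin 4) {c : Site 2}, c ∈ discreteArc P.carrier δ (P.arc i) →
      meshPoint δ c ∈ cthickening r (Q.arc i) := by
    intro i c hc
    have h1 : infDist (meshPoint δ c) (P.arc i) ≤ δ := infDist_le_of_mem_discreteArc P.isOpen hδ hc hfrne
    obtain ⟨p, hp, hpd⟩ := (P.isCompact_arc i).exists_infDist_eq_dist ⟨_, P.pt_mem_arc_self i⟩ (meshPoint δ c)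
    have hp' : p ∈ cthickening ρ (Q.arc i) :=
      arc_subset_cthickening_of_dist_boundary_le Q P hclose hmark i hp
    have := mem_cthickening_of_dist_le _ _ δ _ hp' (by rw [← hpd]; exact h1)
    exact cthickening_mono (by linarith) _ (cthickening_cthickening_subset hδ.le hρ _ this)
  have haS : a ∈ meshDomain P.carrier δ := (discreteArc_subset_meshBoundary _ _ _ ha).1
  have hpath := pathIn_meshDomain_of_reachable haS hreach
  refine hAfor δ t₀ hδ hδ₀ ht₀ le_rfl ω (meshDomain P.carrier δ) a b ?_ ?_
    (hL3 _ (harc 0 ha)).1 (hL3 _ (harc 0 ha)).2 (hL4 _ (harc 2 hb)).1 (hL4 _ (harc 2 hb)).2 hpath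
  · intro x hx hxR
    exact hL1 _ (hPQ (meshDomain_subset_meshVertices _ _ hx)) hxR
  · intro x hx hxR
    have := hL2 _ (hPQ (meshDomain_subset_meshVertices _ _ hx)) hxR
    exact ⟨hδm.trans_le this.1, hδm.trans_le this.2⟩

/-- **Upper inclusion.** If `P` has the marks of `N` and a boundary loop pointwise `ρ`-close to
that of `N`, `ρ ≤ r/4`, then for `0 < δ ≤ r/4` every open crossing of `P_δ` from its arc `0` to
its arc `2` is an open *plate path* of `N` with room `r/2`: an open `ℤ²`-path with all sites in
the closed `r/2`-fattening of `N`, from the `r/2`-fattening of `N.arc 0` to that of `N.arc 2`.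
[folklore] -/
theorem discreteCrossing_subset_plate (N P : ConformalRectangle) {r ρ δ : ℝ}
    (hclose : ∀ u, dist (P.boundary u) (N.boundary u) ≤ ρ) (hmark : ∀ i, P.mark i = N.mark i)
    (hρ : 0 ≤ ρ) (hρr : ρ ≤ r / 4) (hδ : 0 < δ) (hδr : δ ≤ r / 4) :
    discreteCrossing P.carrier δ (P.arc 0) (P.arc 2) ⊆
      openCrossing {x : Site 2 | meshPoint δ x ∈ cthickening (r / 2) N.carrier}
        {x | meshPoint δ x ∈ cthickening (r / 2) (N.arc 0)}
        {x | meshPoint δ x ∈ cthickening (r / 2) (N.arc 2)} := by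
  intro ω hω
  obtain ⟨a, ha, b, hb, hreach⟩ := hω
  have hPN : P.carrier ⊆ cthickening (r / 2) N.carrier :=
    (carrier_subset_cthickening_of_dist_boundary_le N.toJordanDomain P.toJordanDomain hclose).trans
      (cthickening_mono (by linarith) _)
  have hfrne : (frontier P.carrier).Nonempty := ⟨_, P.boundary_mem_frontier 0⟩
  have harc : ∀ (i : Fin 4) {c : Site 2}, c ∈ discreteArc P.carrier δ (P.arc i) →
      meshPoint δ c ∈ cthickening (r / 2) (N.arc i) := by
    intro i c hc
    have h1 : infDist (meshPoint δ c) (P.arc i) ≤ δ := infDist_le_of_mem_discreteArc P.isOpen hδ hc hfrne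
    obtain ⟨p, hp, hpd⟩ := (P.isCompact_arc i).exists_infDist_eq_dist ⟨_, P.pt_mem_arc_self i⟩ (meshPoint δ c)
    have hp' : p ∈ cthickening ρ (N.arc i) :=
      arc_subset_cthickening_of_dist_boundary_le N P hclose hmark i hp
    have := mem_cthickening_of_dist_le _ _ δ _ hp' (by rw [← hpd]; exact h1)
    exact cthickening_mono (by linarith) _ (cthickening_cthickening_subset hδ.le hρ _ this)
  have haS : a ∈ meshDomain P.carrier δ := (discreteArc_subset_meshBoundary _ _ _ ha).1
  have hpath := pathIn_meshDomain_of_reachable haS hreach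
  have hpath' : PathIn (openGraph ω) {x : Site 2 | meshPoint δ x ∈ cthickening (r / 2) N.carrier} a b :=
    pathIn_mono inf_le_left (fun x hx => hPN (meshDomain_subset_meshVertices _ _ hx)) hpath
  exact ⟨a, harc 0 ha, b, harc 2 hb, DCT16.mem_openConnIn_of_pathIn hpath'⟩

/-! ### Probability glue -/

/-- Plate-path events are measurable (countable union of `{u ↔ v in S}`). [folklore] -/
theorem measurableSet_openCrossing_site (S A B : Set (Site 2)) :
    MeasurableSet (openCrossing S A B : Set (BondConfig (Site 2))) := by
  have h : openCrossing S A B = ⋃ x ∈ A, ⋃ y ∈ B, (openConnIn S x y : Set (BondConfig (Site 2))) := by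
    ext ω
    simp only [mem_openCrossing_iff, Set.mem_iUnion, exists_prop]
  rw [h]
  exact MeasurableSet.biUnion (Set.to_countable A) fun x _ =>
    MeasurableSet.biUnion (Set.to_countable B) fun y _ => measurableSet_openConnIn_of_countable S x y

/-- The physical dual position of a site is within `δ` of its mesh point, hence the half-diagonal
offset is absorbed by doubling the room. [folklore] -/
theorem dualScale_mem_cthickening {δ r : ℝ} (hδ : 0 < δ) (hδr : δ ≤ r / 2) {K : Set ℂ} {x : Site 2}
    (hx : meshPoint δ x ∈ cthickening (r / 2) K) : dualScale δ (Site.toComplex x) ∈ cthickening r K := by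
  have hre : dualOffset.re = 1 / 2 := rfl
  have him : dualOffset.im = 1 / 2 := rfl
  have hoff : ‖dualOffset‖ ≤ 1 := by
    refine (Complex.norm_le_abs_re_add_abs_im _).trans ?_
    rw [hre, him]; norm_num
  have hd : dist (dualScale δ (Site.toComplex x)) (meshPoint δ x) ≤ r / 2 := by
    rw [dualScale_toComplex, dist_eq_norm, add_sub_cancel_left, norm_mul, Complex.norm_real,
      Real.norm_of_nonneg hδ.le]
    calc δ * ‖dualOffset‖ ≤ δ * 1 := by gcongr
      _ ≤ r / 2 := by linarith
  have h1 := mem_cthickening_of_dist_le _ _ (r / 2) _ hx hd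
  have h2 := cthickening_cthickening_subset (by linarith : (0 : ℝ) ≤ r / 2) (by linarith : (0 : ℝ) ≤ r / 2) K h1
  rwa [add_halves] at h2

/-- **Upper per-mesh inequality** (bond self-duality at `p = 1/2`): with stub B's constants for
`R` (corner margin `m`) and a comparison rectangle `N` in upper sandwich position with room `r`,
`bond R δ` is at most one minus the probability of an OPEN plate path of the `r/2`-fattening of
`N`. (Port of the glue of line `oracle-sandwich`.) [folklore] -/
theorem bond_le_one_sub_real_openCrossing (R : ConformalRectangle) {m δ₀ t₀ : ℝ}
    (hBfor : ∀ δ t : ℝ, 0 < δ → δ < δ₀ → 0 ≤ t → t ≤ t₀ →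
        ∀ (ω : BondConfig (Site 2)) (S : Set (Site 2)) (u v : Site 2),
          (∀ x ∈ S, dualScale δ (Site.toComplex x) ∉ R.carrier →
            infDist (dualScale δ (Site.toComplex x)) (R.arc 1) ≤ t ∨
              infDist (dualScale δ (Site.toComplex x)) (R.arc 3) ≤ t) →
          (∀ x ∈ S, dualScale δ (Site.toComplex x) ∈ R.carrier →
            3 * δ < infDist (dualScale δ (Site.toComplex x)) (R.arc 0) ∧
              3 * δ < infDist (dualScale δ (Site.toComplex x)) (R.arc 2)) →
          (∀ x ∈ S, dualScale δ (Site.toComplex x) ∈ R.carrier →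
            ∀ j : Fin 4, m ≤ dist (dualScale δ (Site.toComplex x)) (R.pt j)) →
          dualScale δ (Site.toComplex u) ∉ R.carrier →
            infDist (dualScale δ (Site.toComplex u)) (R.arc 1) ≤ t →
          dualScale δ (Site.toComplex v) ∉ R.carrier →
            infDist (dualScale δ (Site.toComplex v)) (R.arc 3) ≤ t →
          PathIn (openGraph (dualConfig ω) ⊓ zdGraph 2) S u v →
          ω ∉ discreteCrossing R.carrier δ (R.arc 0) (R.arc 2))
    {N : ConformalRectangle} {r t δ : ℝ}
    (hU1 : ∀ z ∈ cthickening r N.carrier, z ∉ R.carrier →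
      infDist z (R.arc 1) ≤ t ∨ infDist z (R.arc 3) ≤ t)
    (hU2 : ∀ z ∈ cthickening r N.carrier, z ∈ R.carrier →
      m ≤ infDist z (R.arc 0) ∧ m ≤ infDist z (R.arc 2))
    (hU3 : ∀ z ∈ cthickening r N.carrier, z ∈ R.carrier → ∀ j : Fin 4, m ≤ dist z (R.pt j))
    (hU4 : ∀ z ∈ cthickening r (N.arc 0), z ∉ R.carrier ∧ infDist z (R.arc 1) ≤ t)
    (hU5 : ∀ z ∈ cthickening r (N.arc 2), z ∉ R.carrier ∧ infDist z (R.arc 3) ≤ t)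
    (hδ : 0 < δ) (hδ₀ : δ < δ₀) (h3δ : 3 * δ < m) (hδr : δ ≤ r / 2) (ht : 0 ≤ t) (htt₀ : t ≤ t₀) :
    bondDomainCrossingProb R δ ≤ 1 -
      (bondPercolation (zdGraph 2) half).real
        (openCrossing {x : Site 2 | meshPoint δ x ∈ cthickening (r / 2) N.carrier}
          {x | meshPoint δ x ∈ cthickening (r / 2) (N.arc 0)}
          {x | meshPoint δ x ∈ cthickening (r / 2) (N.arc 2)}) := by
  set E : Set (BondConfig (Site 2)) :=
    openCrossing {x : Site 2 | meshPoint δ x ∈ cthickening (r / 2) N.carrier}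
      {x | meshPoint δ x ∈ cthickening (r / 2) (N.arc 0)}
      {x | meshPoint δ x ∈ cthickening (r / 2) (N.arc 2)} with hE
  have hmeas : MeasurableSet E := measurableSet_openCrossing_site _ _ _
  have key : ∀ {K : Set ℂ} {x : Site 2}, meshPoint δ x ∈ cthickening (r / 2) K →
      dualScale δ (Site.toComplex x) ∈ cthickening r K := fun hx => dualScale_mem_cthickening hδ hδr hx
  have hsub : discreteCrossing R.carrier δ (R.arc 0) (R.arc 2) ⊆ (dualConfig ⁻¹' E)ᶜ := by
    intro ω hω hoc
    rw [Set.mem_preimage, hE] at hoc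
    obtain ⟨u, hu, v, hv, huv⟩ := mem_openCrossing_iff.1 hoc
    have hp : PathIn (openGraph (dualConfig ω) ⊓ zdGraph 2)
        {x : Site 2 | meshPoint δ x ∈ cthickening (r / 2) N.carrier} u v := by
      have h1 := DCT16.pathIn_of_mem_openConnIn huv
      rw [openGraph_inf_eq, Set.inter_eq_left.2 (dualConfig_subset_edgeSet ω)]
      exact h1
    exact hBfor δ t hδ hδ₀ ht htt₀ ω _ u v (fun x hx hxR => hU1 _ (key hx) hxR)
      (fun x hx hxR => ⟨h3δ.trans_le (hU2 _ (key hx) hxR).1, h3δ.trans_le (hU2 _ (key hx) hxR).2⟩)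
      (fun x hx hxR j => hU3 _ (key hx) hxR j)
      (hU4 _ (key hu)).1 (hU4 _ (key hu)).2 (hU5 _ (key hv)).1 (hU5 _ (key hv)).2 hp hω
  calc bondDomainCrossingProb R δ
        = (bondPercolation (zdGraph 2) half).real (discreteCrossing R.carrier δ (R.arc 0) (R.arc 2)) := rfl
    _ ≤ (bondPercolation (zdGraph 2) half).real (dualConfig ⁻¹' E)ᶜ := measureReal_mono hsub
    _ = 1 - (bondPercolation (zdGraph 2) half).real (dualConfig ⁻¹' E) := by
          rw [measureReal_compl (measurable_dualConfig hmeas), probReal_univ]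
    _ = 1 - (bondPercolation (zdGraph 2) half).real E := by
          rw [bondPercolation_half_real_preimage_dualConfig hmeas]

/-- A conformal rectangle whose frontier IS a finite union of axis-parallel segments satisfies the
(weaker, `⊆`) rectilinearity hypothesis of `RectilinearCardy`. [folklore] -/
theorem isRectilinear_of_frontier_eq {P : ConformalRectangle}
    (hS : ∃ S : Finset (ℂ × ℂ), (∀ p ∈ S, p.1.re = p.2.re ∨ p.1.im = p.2.im) ∧
      frontier P.carrier = ⋃ p ∈ S, segment ℝ p.1 p.2) :
    ∃ S : Finset (ℂ × ℂ), (∀ p ∈ S, p.1.re = p.2.re ∨ p.1.im = p.2.im) ∧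
      frontier P.carrier ⊆ ⋃ p ∈ S, segment ℝ p.1 p.2 := by
  obtain ⟨S, hS1, hS2⟩ := hS
  exact ⟨S, hS1, hS2.le⟩


end RectilinearApproximation

end Summit.CriticalPhenomena.CardyFormulaZ2.Theorems
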